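import Summits.BirchSwinnertonDyer.BirchSwinnertonDyer.Theorems.Rank2ObservatoryCubicFieldR167892PIDa
import HarnessLib

/-!
# BirchSwinnertonDyer — rank ≥ 2 observatory: class number one of the cubic field of `-41 + 65 * X - 19 * X ^ 2 + X ^ 3` (`Δ = 167892`) — the PID instance

HONEST FRAMING: per-curve certified theorems and census instruments; no claim on BSD in rank ≥ 2.

Companion of the per-FIELD file `Rank2ObservatoryCubicFieldR167892` of the KERNEL-2DESC instrument (design
`b2b-bsdr2-cert-3/KERNEL-2DESC.md` §9e–§9g): collects the per-prime certificate files
(Rank2ObservatoryCubicFieldR167892PIDa) into the certificate `cert` at every prime below the Minkowski certificate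
bound and the `IsPrincipalIdealRing (𝓞 K)` instance
(`Rank2Observatory2DescPIDCertB.isPrincipalIdealRing_of_cert_lt`). Split off for file size; generated by the same
generator from the same checked data.
Sorry-free; axioms `propext`, `Classical.choice`, `Quot.sound`.
[cite: Marcus2018, Ch. 3 Thm. 27, Ch. 5 Cor. 2 of Thm. 37]
-/

-- single-conjunct summit: `Summit.BirchSwinnertonDyer.BirchSwinnertonDyer.…` repeats the name by design
set_option linter.dupNamespace false

noncomputable section

open scoped Classical NumberField

open Literature.NumberTheory.NumberFields Polynomial Module NumberField

namespace Summit.BirchSwinnertonDyer.BirchSwinnertonDyer.Rank2Observatory.TwoDescCubic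

namespace FieldR167892

/-! ## Class number one -/

/-- The degree-one certificates at all primes below the Minkowski certificate bound `b = 116`
(`64·Δ < 799·b²`). [cite: Marcus2018, Ch. 5, Cor. 2 of Thm 37] -/
theorem cert (p : ℕ) (hpb : p < 116) (hp : p.Prime) (ψ : 𝓞 (CubicField (-19) 65 (-41)) →+* ZMod p) :
    ∃ e : 𝓞 (CubicField (-19) 65 (-41)), ψ e = 0 ∧ Prime e := by
  have h : p ∈ [2, 3, 5, 7, 11, 13, 17, 19, 23, 29, 31, 37, 41, 43, 47, 53, 59, 61, 67, 71, 73, 79, 83, 89, 97, 101, 103, 107, 109, 113] := (by decide +kernel : ∀ p < 116, p.Prime → p ∈ [2, 3, 5, 7, 11, 13, 17, 19, 23, 29, 31, 37, 41, 43, 47, 53, 59, 61, 67, 71, 73, 79, 83, 89, 97, 101, 103, 107, 109, 113]) p hpb hp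
  simp only [List.mem_cons, List.not_mem_nil, or_false] at h
  rcases h with rfl | rfl | rfl | rfl | rfl | rfl | rfl | rfl | rfl | rfl | rfl | rfl | rfl | rfl | rfl | rfl | rfl | rfl | rfl | rfl | rfl | rfl | rfl | rfl | rfl | rfl | rfl | rfl | rfl | rfl
  · exact cert2 ψ
  · exact cert3 ψ
  · exact cert5 ψ
  · exact cert7 ψ
  · exact cert11 ψ
  · exact cert13 ψ
  · exact cert17 ψ
  · exact cert19 ψ
  · exact cert23 ψ
  · exact cert29 ψ
  · exact cert31 ψ
  · exact cert37 ψ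
  · exact cert41 ψ
  · exact cert43 ψ
  · exact cert47 ψ
  · exact cert53 ψ
  · exact cert59 ψ
  · exact cert61 ψ
  · exact cert67 ψ
  · exact cert71 ψ
  · exact cert73 ψ
  · exact cert79 ψ
  · exact cert83 ψ
  · exact cert89 ψ
  · exact cert97 ψ
  · exact cert101 ψ
  · exact cert103 ψ
  · exact cert107 ψ
  · exact cert109 ψ
  · exact cert113 ψ

/-- `𝓞 K` is a PID: `Δ = 167892`, `64·Δ < 799·116²` so the Minkowski bound is `< 116`, and every
prime ideal of norm `< 116` is principal by the degree-one certificates (`Rank2Observatory2DescPIDCertB`).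
[cite: Marcus2018, Ch. 5, Cor. 2 of Thm 37] -/
instance : IsPrincipalIdealRing (𝓞 (CubicField (-19) 65 (-41))) :=
  isPrincipalIdealRing_of_cert_lt irreducible aeval_α finrank_eq (b := 116) (by rw [disc_eq]; norm_num) cert

end FieldR167892

end Summit.BirchSwinnertonDyer.BirchSwinnertonDyer.Rank2Observatory.TwoDescCubic

end
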